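import Literature.Geometry.Hyperkaehler.LefschetzTwistorAlgebraSO41
import Literature.LinearAlgebra.Alternating.GradedFormsRing
import Mathlib.Algebra.Algebra.Subalgebra.Lattice
import HarnessLib

/-!
# The subalgebra generated by the Kähler forms of the induced complex structures is invariant under the
# Lie algebra `𝔞 ≅ 𝔰𝔬(4,1)` of their Lefschetz operators (Looijenga–Lunts 1997 §4 (4.2)(iv), (4.4)(iii))

Topic `Literature/Geometry/Hyperkaehler`, namespace `Literature.Geometry.Hyperkaehler.IsLinearHyperkaehler`
(with a torus-general §1 in `Literature.Geometry.Kaehler.ComplexTorus`). Lane `lit-hodgefound` (Track 2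
foundations library), prover seat p06 (generation 16), self-proposed row g16-#4; sequel of Q1622
(`LefschetzTwistorCommutators.lean`) and Q1747 (`LefschetzTwistorAlgebraSO41.lean`: the Lie algebra
`𝔞 = verbitskyAlgebra g₀ J ≅ 𝔰𝔬(4,1)` generated by the Lefschetz operators `L_u` and dual Lefschetz operators
`Λ_v` of the Kähler forms `ω_{λ_u}` of all the induced complex structures `λ_u = u₀I + u₁J + u₂K` of a
quaternionic Hermitian vector space, on the graded forms `GForm E ℂ = ⊕ₖ ⋀ᵏ V^* ⊗ ℂ = H•(X, ℂ)` of the torus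
`X = E/Λ`; its multiplication table `lie_A_L`, `lie_L_Λ`, …; `mem_verbitskyAlgebra_iff`:
`𝔞 = {L_u + Λ_v + ad λ_w + t h}`). Theorems only; no definition, no named fact, no `sorry`.

## Sources, verbatim

* E. Looijenga, V. A. Lunts, *A Lie algebra attached to a projective variety*, Invent. Math. 129 (1997)
  361–412 = alg-geom/9604014 [held corpus text `paper:arxiv-alg-geom_9604014` p0017 L17–L30 and L45–L64, p0018 L70–L103,
  p0010 L56–L59],
  §4 **(4.2) Lemma (iv)**: "The subalgebra `M ⊂ ∧•V` generated by the `κ_J`'s is invariant under the star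
  operator and `𝔤(ℍ)`, and `M[2m]` becomes a Jordan–Lefschetz module of `(𝔤(ℍ), h)` of level `m`."  Here
  (§4 (4.1), p0017 L17–L30) `κ_J ∈ ∧²V` is the Kähler form of `J ∈ ℍ₀ ∩ ℍ₁`, "Wedging with `κ_J` defines an
  operator in `∧V[2m]` that we denote by `e_J`", "`f_a = Nm(a)⁻¹ ⋆e_a⋆⁻¹`", and `𝔤(V)` ("`𝔤(ℍ)`") is "the Lie
  algebra generated by these elements".  §4 **(4.4) Proposition (iii)**: "The subalgebra `A_𝔞 ⊂ H(X;ℝ)`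
  generated by `𝔞` is invariant under the star operator and `𝔤(ℍ)` and `A_𝔞[2m]` is a Jordan–Lefschetz module
  of `𝔤(ℍ)` of level `m`. […] As for (iii), note that `A_𝔞` is additively spanned by the subalgebra's `ℝ[a]`,
  with `a ∈ 𝔞` nonzero. As such a subalgebra is invariant under `⋆`, so is `A_𝔞`. Hence `A_𝔞` is also
  invariant under `f_a`. The rest of the assertion is clear."  §2 (2.7): "given a Jordan–Lefschetz pair
  `(𝔤, h)`, then an irreducible representation `M` of `𝔤` is a Jordan–Lefschetz module if and only if it has
  a nonzero vector stabilized by `𝔤₋₂ + 𝔤₀`."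
* M. Verbitsky, *Hyperholomorphic sheaves and new examples of hyperkähler manifolds*, alg-geom/9712012, §4.2
  [held `paper:arxiv-alg-geom_9712012` p0017 L55–L86]: "Let `M, ℋ` be a hyperkähler manifold, and `𝔞_ℋ` be a Lie
  algebra generated by `L_R` and `Λ_R` for all induced complex structures `R` over `M`. Then the Lie algebra `𝔞_ℋ`
  is isomorphic to `𝔰𝔬(4,1)`" (the tree's `verbitskyAlgebra g₀ J`, Q1747); the same algebra "generated by
  `L_{x_i}`, `Λ_{x_i}`, `i = 1,2,3`" in M. Verbitsky, *Cohomology of compact hyperkaehler manifolds*,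
  alg-geom/9501001 [held `paper:arxiv-alg-geom_9501001` p0015 L82–L86].
* D. Huybrechts, *Complex Geometry* (2005), Prop. 1.2.26: the Lefschetz operator `L = ω ∧ ·`; F. W. Warner,
  *Foundations of Differentiable Manifolds and Lie Groups* (1983), 2.6: `∧` is bilinear, associative and
  graded-commutative (the tree's ring `GForm V A`, `GradedFormsRing.lean`).

## What is formalised (pointwise = linear algebra on one quaternionic Hermitian space; `E ≠ 0` where `Λ` enters)

The carrier is the complex algebra `(GForm E ℂ, +, *)` of `GradedFormsRing.lean` (`* = ∧`, `1` = the constant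
`0`-form); `A_𝔞` is rendered, with NO new definition, as Mathlib's
`Algebra.adjoin ℂ (Set.range fun u : Fin 3 → ℝ ↦ lefschetzTwistor g₀ J u 1)` — the complex subalgebra generated
by the Kähler forms `κ_u := L_u(1) = ω_{λ_u} ⊗ ℂ ∈ ⋀²` of ALL the induced complex structures (Looijenga–Lunts'
"generated by the `κ_J`'s" / "generated by `𝔞`", `𝔞 = ` the characteristic `3`-plane `{κ_u}`); "invariant under
`𝔤(ℍ)`" is `𝔞 ≤ stabilizer (A_𝔞)` with the tree's `stabilizer` (`ComplexTorusTotalLieAlgebra.lean`).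

§1 (any complex torus) **`lefschetzG_eq_mul`: `L_κ w = (κ ⊗ ℂ) * w`** — the Lefschetz operator `lefschetzG κ` of
Q941/A1-26 IS left multiplication by `of 2 (ofRealForm κ)` in the graded ring ("Wedging with `κ_J` defines an
operator … `e_J`"); `lefschetzG_one_eq_of` (`L_κ 1 = κ ⊗ ℂ`), `lefschetzG_eq_mul_apply_one`.
§2 `lefschetzTwistor_apply_one` (`κ_u = L_u 1 = of 2 (ω_{λ_u} ⊗ ℂ)`), `lefschetzTwistor_apply_eq_mul` (`L_u w = κ_u * w`);
the unit `1 ∈ H⁰` is a lowest vector: `adTwistor_apply_one` (`ad λ_w 1 = 0`), `lefschetzDualTwistor_apply_one`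
(`Λ_v 1 = 0`), `countingG_apply_one` (`h 1 = −n·1`) — "a nonzero vector stabilized by `𝔤₋₂ + 𝔤₀`" ((2.7)).
§3 The algebra `A_𝔞`: `toSubmodule_adjoin_eq_span` — **`A_𝔞` is additively spanned by the monomials
`L_{u₁} ⋯ L_{u_r} 1 = κ_{u₁} ∧ ⋯ ∧ κ_{u_r}`** (`prod_map_lefschetzTwistor_apply_one`, `coe_closure_eq_range`), which are
homogeneous of even degree (`exists_isHomog_of_mem_closure`); hence `adjoin_le_evenForms` (`A_𝔞 ⊂ ⋀^{ev}`),
`of_apply_mem_adjoin` (`A_𝔞` is graded: it contains the homogeneous components of its elements),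
`commute_of_mem_adjoin` (`A_𝔞` is central in the graded-commutative `⋀•`), `adjoin_range_eq_adjoin_three`
(`A_𝔞` is generated by `ω_I, ω_J, ω_K` alone), `of_two_fundamentalForm_mem_adjoin`.
§4 **Invariance.** `lefschetzTwistor_apply_mem_adjoin` (`L_u A_𝔞 ⊆ A_𝔞`, multiplication by a generator);
`countingG_apply_mem_adjoin_of_mem_closure` (`h`, by homogeneity); **`adTwistor_apply_mem_adjoin_of_mem_closure`**
(`ad λ_w`, by induction along the monomials from `ad λ_w 1 = 0` and Q1747's `[ad λ_w, L_u] = −2L_{w×u}`);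
**`lefschetzDualTwistor_apply_mem_adjoin_of_mem_closure`** (`Λ_v`, likewise from `Λ_v 1 = 0` and
`[L_u, Λ_v] = ⟨u,v⟩h + ad λ_{u×v}`) — an algebraic replacement of Looijenga–Lunts' `⋆`-argument for "Hence `A_𝔞`
is also invariant under `f_a`"; `apply_mem_adjoin_of_closure` (a linear map preserving the monomials preserves
their span); and the statement as printed, **`verbitskyAlgebra_le_stabilizer_adjoin : 𝔞 ≤ stabilizer A_𝔞`**
("`A_𝔞` … is invariant under … `𝔤(ℍ)`"), with the corollaries `isotropyAlgebra_le_stabilizer_adjoin` (Verbitsky's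
`𝔤 ≅ 𝔰𝔲(2)`), `apply_mem_adjoin_of_mem_verbitskyAlgebra`, `lefschetzG_apply_mem_adjoin`,
`lefschetzDualG_apply_mem_adjoin` (the generators `L_{ω_λ}`, `Λ_{ω_λ}`, `λ ∈ S²`, of `𝔞` preserve `A_𝔞`).

SCOPE NOTE (faithfulness). NOT in this file: the invariance of `A_𝔞` under the Hodge star operator `⋆` (the
tree's `𝔞` is generated by the `L`'s and `Λ`'s directly, so `⋆` is not needed for the `𝔤(ℍ)`-invariance), and
the second clause "`A_𝔞[2m]` is a Jordan–Lefschetz module of `𝔤(ℍ)` of level `m`" (irreducibility and the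
level); nothing here concerns manifolds or cohomology beyond the torus model `H•(E/Λ, ℂ) = GForm E ℂ`.

## References

* [LooijengaLunts1997] E. Looijenga, V. A. Lunts, *A Lie algebra attached to a projective variety*, Invent.
  Math. 129 (1997) 361–412, §2 (2.7), §4 (4.1), (4.2)(iv), (4.4)(iii).
* [Verbitsky1997HyperholomorphicSheaves] M. Verbitsky, *Hyperholomorphic sheaves and new examples of
  hyperkähler manifolds*, alg-geom/9712012, §4.2 (`𝔞_ℋ` generated by the `L_R, Λ_R`; `𝔞_ℋ ≅ 𝔰𝔬(4,1)`, `𝔤_ℋ ≅ 𝔰𝔲(2)`).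
* [Verbitsky1996Hyperholomorphic] M. Verbitsky, *Hyperholomorphic bundles over a hyperkähler manifold*,
  J. Alg. Geom. 5 (1996) = alg-geom/9307008, §1 (`ad I` as a derivation).
* [Huybrechts2005] D. Huybrechts, *Complex Geometry*, Springer (2005), Prop. 1.2.26 (`L = ω ∧ ·`, `Λ`, `H`).
* [Warner1983] F. W. Warner, *Foundations of Differentiable Manifolds and Lie Groups*, GTM 94 (1983), 2.6.
-/

noncomputable section

open Module Function Complex
open Literature.LinearAlgebra.Alternating
open scoped Matrix

/-! ## §1 The Lefschetz operator is left multiplication by the Kähler form in the graded ring -/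

namespace Literature.Geometry.Kaehler.ComplexTorus

variable {E : Type*} [NormedAddCommGroup E] [NormedSpace ℂ E] [FiniteDimensional ℂ E]

omit [FiniteDimensional ℂ E] in
/-- `of 2 θ = of (2·1) θ^{∧1}` (the first wedge power `1 ∧ θ` of the tree's `wedgePow`, read in the graded ring).
[cite: Warner1983, 2.6] -/
theorem of_two_eq_of_wedgePow_one (θ : E [⋀^Fin 2]→L[ℝ] ℂ) :
    (GForm.of 2 θ : GForm E ℂ) = GForm.of (2 * 1) (wedgePow θ 1) :=
  calc (GForm.of 2 θ : GForm E ℂ) = 1 * GForm.of 2 θ := (one_mul _).symm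
    _ = GForm.of 0 (Literature.Analysis.Complex.oneForm₀ E) * GForm.of 2 θ := rfl
    _ = GForm.of (0 + 2) ((Literature.Analysis.Complex.oneForm₀ E).wedge θ) := GForm.of_mul_of 0 2 _ _
    _ = GForm.of (2 * 1) (wedgePow θ 1) := rfl

omit [FiniteDimensional ℂ E] in
/-- **`L_κ = (κ ⊗ ℂ) ∧ ·` on homogeneous forms**: `L_κ (of k α) = of 2 (κ ⊗ ℂ) * of k α` in the graded ring
("Wedging with `κ_J` defines an operator in `∧V[2m]` that we denote by `e_J`").
[cite: Huybrechts2005, Prop. 1.2.26] [cite: LooijengaLunts1997, §4 (4.1)] -/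
theorem lefschetzG_of_eq_mul (κ : E [⋀^Fin 2]→L[ℝ] ℝ) (k : ℕ) (α : E [⋀^Fin k]→L[ℝ] ℂ) :
    lefschetzG κ (GForm.of k α) = GForm.of 2 (ofRealForm κ) * GForm.of k α := by
  rw [lefschetzG_of, of_two_eq_of_wedgePow_one, GForm.of_mul_of]
  exact GForm.of_domDomCongr_finCongr _ _

/-- **`L_κ w = (κ ⊗ ℂ) * w` for every graded form `w`**: the Lefschetz operator of a real `2`-form on
`H•(X, ℂ) = GForm E ℂ` is left multiplication by `of 2 (κ ⊗ ℂ)` in the graded ring.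
[cite: Huybrechts2005, Prop. 1.2.26] [cite: Warner1983, 2.6] -/
theorem lefschetzG_eq_mul (κ : E [⋀^Fin 2]→L[ℝ] ℝ) (w : GForm E ℂ) :
    lefschetzG κ w = GForm.of 2 (ofRealForm κ) * w := by
  conv_lhs => rw [← sum_range_of_eq w]
  conv_rhs => rw [← sum_range_of_eq w]
  rw [map_sum, Finset.mul_sum]
  exact Finset.sum_congr rfl fun m _ ↦ lefschetzG_of_eq_mul κ m (w m)

/-- **`L_κ 1 = κ ⊗ ℂ`**: the Lefschetz operator sends the unit `1 ∈ H⁰` to the Kähler form in `H²`.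
[cite: LooijengaLunts1997, §2 (2.8) ("the natural map 𝔤² ⊗ M_{-n} → M_{-n+2}")] [cite: Huybrechts2005, Prop. 1.2.26] -/
theorem lefschetzG_one_eq_of (κ : E [⋀^Fin 2]→L[ℝ] ℝ) :
    lefschetzG κ (1 : GForm E ℂ) = GForm.of 2 (ofRealForm κ) := by
  rw [lefschetzG_eq_mul, mul_one]

/-- `L_κ w = L_κ(1) * w`. [cite: Huybrechts2005, Prop. 1.2.26] -/
theorem lefschetzG_eq_mul_apply_one (κ : E [⋀^Fin 2]→L[ℝ] ℝ) (w : GForm E ℂ) :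
    lefschetzG κ w = lefschetzG κ 1 * w := by
  rw [lefschetzG_one_eq_of, lefschetzG_eq_mul]

end Literature.Geometry.Kaehler.ComplexTorus

/-! ## §2 The Kähler forms `κ_u = L_u 1` and the lowest vector `1` -/

namespace Literature.Geometry.Hyperkaehler

namespace IsLinearHyperkaehler

open Literature.Geometry.Kaehler Literature.Geometry.Kaehler.ComplexTorus

variable {E : Type*} [NormedAddCommGroup E] [NormedSpace ℂ E] [FiniteDimensional ℂ E]
  {g₀ : E →L[ℝ] E →L[ℝ] ℝ} {J : E →L[ℝ] E}

/-- **`κ_u := L_u 1 = ω_{λ_u} ⊗ ℂ`**, the (complexified) Kähler form of `λ_u = u₀I + u₁J + u₂K` as an element of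
`H² ⊂ H•(X, ℂ)` ("`κ_J ∈ ∧²V`"). [cite: LooijengaLunts1997, §4 (4.1)] -/
theorem lefschetzTwistor_apply_one (u : Fin 3 → ℝ) :
    lefschetzTwistor g₀ J u 1 = GForm.of 2 (ofRealForm (fundamentalForm g₀ (u 0 • opI E + u 1 • J + u 2 • opK J))) := by
  rw [lefschetzTwistor_apply, lefschetzG_one_eq_of]

/-- **`L_u w = κ_u ∧ w`**: `e_u` is multiplication by `κ_u` ("Wedging with `κ_J` defines an operator … `e_J`").
[cite: LooijengaLunts1997, §4 (4.1)] -/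
theorem lefschetzTwistor_apply_eq_mul (u : Fin 3 → ℝ) (w : GForm E ℂ) :
    lefschetzTwistor g₀ J u w = lefschetzTwistor g₀ J u 1 * w := by
  rw [lefschetzTwistor_apply, lefschetzG_eq_mul_apply_one]

/-- `ad λ_w 1 = 0`: the degree-`0` derivations kill the unit (`1` is stabilised by `𝔤₀`).
[cite: LooijengaLunts1997, §2 (2.7)] [cite: Verbitsky1996Hyperholomorphic, §1] -/
theorem adTwistor_apply_one (w : Fin 3 → ℝ) : adTwistor J w (1 : GForm E ℂ) = 0 := by
  rw [GForm.one_def, adTwistor_of, adAlt_of_degree_zero, GForm.of_zero]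

omit [FiniteDimensional ℂ E] in
/-- `h 1 = −n · 1` (`n = dim_ℂ E`): the unit spans the lowest piece `M_{-n}` of `H•(X)[n]`.
[cite: LooijengaLunts1997, §2 (2.7)–(2.8)] [cite: Huybrechts2005, Def. 1.2.25] -/
theorem countingG_apply_one : countingG E (1 : GForm E ℂ) = (-(finrank ℂ E : ℂ)) • (1 : GForm E ℂ) := by
  rw [GForm.one_def, countingG_of, Nat.cast_zero, zero_sub]

/-- `Λ_v 1 = 0`: the unit is annihilated by `𝔤₋₂` ("a nonzero vector stabilized by `𝔤₋₂ + 𝔤₀`").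
[cite: LooijengaLunts1997, §2 (2.7)] -/
theorem lefschetzDualTwistor_apply_one [Nontrivial E] (h : IsLinearHyperkaehler g₀ J) (v : Fin 3 → ℝ) :
    h.lefschetzDualTwistor v (1 : GForm E ℂ) = 0 := by
  rw [h.lefschetzDualTwistor_eq_smul, LinearMap.smul_apply, GForm.one_def, lefschetzDualG_of_of_lt_two _ (by norm_num),
    smul_zero]

/-! ## §3 The subalgebra `A_𝔞 = ℂ[κ_u : u ∈ ℝ³]` generated by the Kähler forms: monomials, grading, generators -/

/-- The monomial operators on the unit are the monomials: `L_{u₁} ⋯ L_{u_r} 1 = κ_{u₁} ∧ ⋯ ∧ κ_{u_r}`.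
[cite: LooijengaLunts1997, §4 (4.4) (iii) (proof: "additively spanned by the subalgebra's ℝ[a]")] -/
theorem prod_map_lefschetzTwistor_apply_one (l : List (Fin 3 → ℝ)) :
    (l.map (lefschetzTwistor g₀ J)).prod (1 : GForm E ℂ) = (l.map fun u : Fin 3 → ℝ ↦ lefschetzTwistor g₀ J u 1).prod := by
  induction l with
  | nil => rw [List.map_nil, List.map_nil, List.prod_nil, List.prod_nil, Module.End.one_apply]
  | cons u l ih => rw [List.map_cons, List.map_cons, List.prod_cons, List.prod_cons, Module.End.mul_apply, ih,
      lefschetzTwistor_apply_eq_mul]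

/-- The multiplicative monoid generated by the Kähler forms `κ_u` is the set of monomials `L_{u₁} ⋯ L_{u_r} 1`.
[cite: LooijengaLunts1997, §4 (4.4) (iii) (proof)] -/
theorem coe_closure_eq_range :
    (Submonoid.closure (Set.range fun u : Fin 3 → ℝ ↦ lefschetzTwistor g₀ J u (1 : GForm E ℂ)) : Set (GForm E ℂ)) =
      Set.range fun l : List (Fin 3 → ℝ) ↦ (l.map (lefschetzTwistor g₀ J)).prod 1 := by
  ext x
  constructor
  · intro hx
    induction hx using Submonoid.closure_induction_left with
    | one => exact ⟨[], by beta_reduce; rw [List.map_nil, List.prod_nil, Module.End.one_apply]⟩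
    | mul_left g hg y hy ih =>
      obtain ⟨u, rfl⟩ := hg
      obtain ⟨l, rfl⟩ := ih
      refine ⟨u :: l, ?_⟩
      beta_reduce
      rw [List.map_cons, List.prod_cons, Module.End.mul_apply, ← lefschetzTwistor_apply_eq_mul]
  · rintro ⟨l, rfl⟩
    beta_reduce
    rw [SetLike.mem_coe, prod_map_lefschetzTwistor_apply_one]
    exact Submonoid.list_prod_mem _ fun y hy ↦ by
      obtain ⟨u, -, rfl⟩ := List.mem_map.1 hy
      exact Submonoid.subset_closure ⟨u, rfl⟩

/-- **`A_𝔞` is additively spanned by the monomials `L_{u₁} ⋯ L_{u_r} 1`** (equivalently `A_𝔞 = U(𝔞₂)·1`, the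
`U𝔤₂`-module generated by the lowest vector): "`A_𝔞` is additively spanned by the subalgebra's `ℝ[a]`, with
`a ∈ 𝔞` nonzero". [cite: LooijengaLunts1997, §4 (4.4) (iii) (proof), §2 (2.3)] -/
theorem toSubmodule_adjoin_eq_span :
    Subalgebra.toSubmodule (Algebra.adjoin ℂ (Set.range fun u : Fin 3 → ℝ ↦ lefschetzTwistor g₀ J u (1 : GForm E ℂ))) =
      Submodule.span ℂ (Set.range fun l : List (Fin 3 → ℝ) ↦ (l.map (lefschetzTwistor g₀ J)).prod 1) := by
  rw [Algebra.adjoin_eq_span, coe_closure_eq_range]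

/-- The Kähler form `ω_{λ_u} ⊗ ℂ` of every induced complex structure lies in `A_𝔞` (it is the generator `κ_u`).
[cite: LooijengaLunts1997, §4 (4.2) (iv)] -/
theorem of_two_fundamentalForm_mem_adjoin (u : Fin 3 → ℝ) :
    GForm.of 2 (ofRealForm (fundamentalForm g₀ (u 0 • opI E + u 1 • J + u 2 • opK J))) ∈
      Algebra.adjoin ℂ (Set.range fun u : Fin 3 → ℝ ↦ lefschetzTwistor g₀ J u (1 : GForm E ℂ)) := by
  rw [← lefschetzTwistor_apply_one]
  exact Algebra.subset_adjoin ⟨u, rfl⟩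

/-- **`A_𝔞 = ℂ[ω_I, ω_J, ω_K]`**: the subalgebra generated by the Kähler forms of all the induced complex structures
is generated by the three forms `ω_I, ω_J, ω_K` (`κ_u = u₀ω_I + u₁ω_J + u₂ω_K`, Q1747 `lefschetzTwistor_eq_sum`).
[cite: LooijengaLunts1997, §4 (4.2) (iv)] [cite: Verbitsky1997HyperholomorphicSheaves, §4.2 (R = I, J, K)] -/
theorem adjoin_range_eq_adjoin_three :
    Algebra.adjoin ℂ (Set.range fun u : Fin 3 → ℝ ↦ lefschetzTwistor g₀ J u (1 : GForm E ℂ)) =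
      Algebra.adjoin ℂ {GForm.of 2 (ofRealForm (fundamentalForm g₀ (opI E))), GForm.of 2 (ofRealForm (fundamentalForm g₀ J)),
        GForm.of 2 (ofRealForm (fundamentalForm g₀ (opK J)))} := by
  apply le_antisymm
  · refine Algebra.adjoin_le ?_
    rintro _ ⟨u, rfl⟩
    have e := LinearMap.congr_fun (lefschetzTwistor_eq_sum (g₀ := g₀) (J := J) u) (1 : GForm E ℂ)
    beta_reduce
    rw [e]
    simp only [LinearMap.add_apply, LinearMap.smul_apply, lefschetzG_one_eq_of, RCLike.real_smul_eq_coe_smul (K := ℂ)]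
    refine add_mem (add_mem (Subalgebra.smul_mem _ (Algebra.subset_adjoin ?_) _)
      (Subalgebra.smul_mem _ (Algebra.subset_adjoin ?_) _)) (Subalgebra.smul_mem _ (Algebra.subset_adjoin ?_) _)
    · exact Or.inl rfl
    · exact Or.inr (Or.inl rfl)
    · exact Or.inr (Or.inr rfl)
  · refine Algebra.adjoin_le ?_
    rintro x (rfl | rfl | rfl)
    · rw [SetLike.mem_coe, ← lefschetzG_one_eq_of, ← lefschetzTwistor_single_zero]
      exact Algebra.subset_adjoin ⟨_, rfl⟩
    · rw [SetLike.mem_coe, ← lefschetzG_one_eq_of, ← lefschetzTwistor_single_one (g₀ := g₀)]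
      exact Algebra.subset_adjoin ⟨_, rfl⟩
    · rw [SetLike.mem_coe, ← lefschetzG_one_eq_of, ← lefschetzTwistor_single_two (g₀ := g₀)]
      exact Algebra.subset_adjoin ⟨_, rfl⟩

/-- Every monomial `L_{u₁} ⋯ L_{u_r} 1` in the Kähler forms is homogeneous of even degree `2r`.
[cite: Warner1983, 2.6] [cite: LooijengaLunts1997, §4 (4.2) (iv)] -/
theorem exists_isHomog_of_mem_closure {x : GForm E ℂ}
    (hx : x ∈ Submonoid.closure (Set.range fun u : Fin 3 → ℝ ↦ lefschetzTwistor g₀ J u 1)) :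
    ∃ r : ℕ, GForm.IsHomog (2 * r) x := by
  induction hx using Submonoid.closure_induction with
  | mem x hx =>
    obtain ⟨u, rfl⟩ := hx
    refine ⟨1, ?_⟩
    beta_reduce
    rw [lefschetzTwistor_apply_one]
    exact GForm.IsHomog.of _ _
  | one => exact ⟨0, GForm.IsHomog.one⟩
  | mul x y _ _ hx hy =>
    obtain ⟨r, hr⟩ := hx
    obtain ⟨s, hs⟩ := hy
    exact ⟨r + s, by rw [mul_add]; exact hr.mul hs⟩

omit [FiniteDimensional ℂ E] in
/-- Monomials lie in the generated subalgebra. [cite: Warner1983, 2.6] -/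
theorem mem_adjoin_of_mem_closure {S : Set (GForm E ℂ)} {x : GForm E ℂ} (hx : x ∈ Submonoid.closure S) :
    x ∈ Algebra.adjoin ℂ S :=
  Submonoid.closure_le.2 (Algebra.subset_adjoin (R := ℂ) (s := S)) hx

omit [FiniteDimensional ℂ E] in
/-- A `ℂ`-linear endomorphism of `H•(X, ℂ)` which maps the monomials in a set of generators into the generated
subalgebra maps the whole subalgebra into itself (the subalgebra is the span of the monomials).
[cite: LooijengaLunts1997, §4 (4.4) (iii) (proof: "A_𝔞 is additively spanned by …")] -/
theorem apply_mem_adjoin_of_closure {S : Set (GForm E ℂ)} (T : Module.End ℂ (GForm E ℂ))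
    (hT : ∀ x ∈ Submonoid.closure S, T x ∈ Algebra.adjoin ℂ S) :
    ∀ x ∈ Algebra.adjoin ℂ S, T x ∈ Algebra.adjoin ℂ S := by
  intro x hx
  rw [← Subalgebra.mem_toSubmodule, Algebra.adjoin_eq_span] at hx ⊢
  refine (Submodule.span_le (p := (Submodule.span ℂ (Submonoid.closure S : Set (GForm E ℂ))).comap T)).2
    (fun y hy ↦ ?_) hx
  have e := hT y hy
  rw [← Subalgebra.mem_toSubmodule, Algebra.adjoin_eq_span] at e
  exact e

/-- **`A_𝔞 ⊂ ⋀^{ev}`**: the subalgebra generated by the Kähler forms consists of even forms (so `𝔤(ℍ)` acts on it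
inside `∧^{ev}V`). [cite: LooijengaLunts1997, §4 (4.2) (iv) and proof ("𝔤(ℍ) acts on ∧^{ev}V via M")] -/
theorem adjoin_le_evenForms :
    Subalgebra.toSubmodule (Algebra.adjoin ℂ (Set.range fun u : Fin 3 → ℝ ↦ lefschetzTwistor g₀ J u 1)) ≤ evenForms E := by
  rw [Algebra.adjoin_eq_span, Submodule.span_le]
  intro x hx
  obtain ⟨r, hr⟩ := exists_isHomog_of_mem_closure hx
  exact mem_evenForms_iff.2 fun m hm ↦ hr m fun e ↦ (Nat.not_even_iff_odd.2 hm) (e ▸ even_two_mul r)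

/-- **`A_𝔞` is graded**: with a form it contains each of its homogeneous components (`A_𝔞 = ⊕_k A_𝔞 ∩ ⋀^{2k}`,
the grading of "`A_𝔞[2m]`"). [cite: LooijengaLunts1997, §4 (4.4) (iii)] -/
theorem of_apply_mem_adjoin {x : GForm E ℂ}
    (hx : x ∈ Algebra.adjoin ℂ (Set.range fun u : Fin 3 → ℝ ↦ lefschetzTwistor g₀ J u (1 : GForm E ℂ))) (m : ℕ) :
    GForm.of m (x m) ∈ Algebra.adjoin ℂ (Set.range fun u : Fin 3 → ℝ ↦ lefschetzTwistor g₀ J u (1 : GForm E ℂ)) := by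
  have key := apply_mem_adjoin_of_closure
    (LinearMap.single ℂ (fun m : ℕ ↦ E [⋀^Fin m]→L[ℝ] ℂ) m ∘ₗ LinearMap.proj m) (fun y hy ↦ ?_) x hx
  · exact key
  · obtain ⟨r, hr⟩ := exists_isHomog_of_mem_closure hy
    change GForm.of m (y m) ∈ _
    by_cases hm : m = 2 * r
    · subst hm
      rw [← hr.eq_of]
      exact mem_adjoin_of_mem_closure hy
    · rw [hr m hm, GForm.of_zero]
      exact zero_mem _

/-- **`A_𝔞` is central in `⋀•`**: its elements (even forms) commute with every graded form (graded commutativity).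
[cite: Warner1983, 2.6] -/
theorem commute_of_mem_adjoin {x : GForm E ℂ}
    (hx : x ∈ Algebra.adjoin ℂ (Set.range fun u : Fin 3 → ℝ ↦ lefschetzTwistor g₀ J u (1 : GForm E ℂ))) (z : GForm E ℂ) :
    Commute z x := by
  refine Algebra.commute_of_mem_adjoin_of_forall_mem_commute hx ?_
  rintro _ ⟨u, rfl⟩
  beta_reduce
  rw [lefschetzTwistor_apply_one]
  exact (GForm.of_mul_comm_of_even (by decide) _ z).symm

/-! ## §4 Invariance of `A_𝔞` under `L_u`, `h`, `ad λ_w`, `Λ_v`, and under `𝔞 ≅ 𝔰𝔬(4,1)` -/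

/-- `h A_𝔞 ⊆ A_𝔞` on monomials: `h` acts on the monomial of degree `2r` by the scalar `2r − n`.
[cite: LooijengaLunts1997, §4 (4.2) (iv)] [cite: Huybrechts2005, Def. 1.2.25] -/
theorem countingG_apply_mem_adjoin_of_mem_closure {x : GForm E ℂ}
    (hx : x ∈ Submonoid.closure (Set.range fun u : Fin 3 → ℝ ↦ lefschetzTwistor g₀ J u 1)) :
    countingG E x ∈ Algebra.adjoin ℂ (Set.range fun u : Fin 3 → ℝ ↦ lefschetzTwistor g₀ J u 1) := by
  obtain ⟨r, hr⟩ := exists_isHomog_of_mem_closure hx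
  rw [hr.eq_of, countingG_of, ← hr.eq_of]
  exact Subalgebra.smul_mem _ (mem_adjoin_of_mem_closure hx) _

/-- **`L_u A_𝔞 ⊆ A_𝔞`** (`e_u` is multiplication by the generator `κ_u`). [cite: LooijengaLunts1997, §4 (4.2) (iv)] -/
theorem lefschetzTwistor_apply_mem_adjoin (u : Fin 3 → ℝ) {x : GForm E ℂ}
    (hx : x ∈ Algebra.adjoin ℂ (Set.range fun u : Fin 3 → ℝ ↦ lefschetzTwistor g₀ J u 1)) :
    lefschetzTwistor g₀ J u x ∈ Algebra.adjoin ℂ (Set.range fun u : Fin 3 → ℝ ↦ lefschetzTwistor g₀ J u 1) := by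
  rw [lefschetzTwistor_apply_eq_mul]
  exact mul_mem (Algebra.subset_adjoin ⟨u, rfl⟩) hx

/-- **`ad λ_w A_𝔞 ⊆ A_𝔞`** on monomials, by induction along `L_{u₁} ⋯ L_{u_r} 1`: `ad λ_w 1 = 0` and
`ad λ_w (κ_u ∧ y) = κ_u ∧ ad λ_w y − 2 κ_{w×u} ∧ y` (Q1747 `[ad λ_w, L_u] = −2 L_{w×u}`; `ad λ_w` is a derivation and
rotates the characteristic `3`-plane). [cite: LooijengaLunts1997, §4 (4.2) (iv)] [cite: Verbitsky1996Hyperholomorphic, §1] -/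
theorem adTwistor_apply_mem_adjoin_of_mem_closure (h : IsLinearHyperkaehler g₀ J) (w : Fin 3 → ℝ) {x : GForm E ℂ}
    (hx : x ∈ Submonoid.closure (Set.range fun u : Fin 3 → ℝ ↦ lefschetzTwistor g₀ J u 1)) :
    adTwistor J w x ∈ Algebra.adjoin ℂ (Set.range fun u : Fin 3 → ℝ ↦ lefschetzTwistor g₀ J u 1) := by
  induction hx using Submonoid.closure_induction_left with
  | one => rw [adTwistor_apply_one]; exact zero_mem _
  | mul_left g hg y hy ih =>
    obtain ⟨u, rfl⟩ := hg
    have e : adTwistor J w (lefschetzTwistor g₀ J u y) - lefschetzTwistor g₀ J u (adTwistor J w y) =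
        ((-2 : ℝ) • lefschetzTwistor g₀ J (w ⨯₃ u)) y := LinearMap.congr_fun (h.lie_A_L w u) y
    rw [← lefschetzTwistor_apply_eq_mul, ← sub_add_cancel (adTwistor J w (lefschetzTwistor g₀ J u y))
      (lefschetzTwistor g₀ J u (adTwistor J w y)), e, LinearMap.smul_apply, RCLike.real_smul_eq_coe_smul (K := ℂ)]
    exact add_mem (Subalgebra.smul_mem _ (lefschetzTwistor_apply_mem_adjoin _ (mem_adjoin_of_mem_closure hy)) _)
      (lefschetzTwistor_apply_mem_adjoin u ih)

/-- **`Λ_v A_𝔞 ⊆ A_𝔞`** on monomials ("Hence `A_𝔞` is also invariant under `f_a`"), by induction along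
`L_{u₁} ⋯ L_{u_r} 1` without the star operator: `Λ_v 1 = 0` and
`Λ_v (κ_u ∧ y) = κ_u ∧ Λ_v y − ⟨u,v⟩ h y − ad λ_{u×v} y` (Q1747 `[L_u, Λ_v] = ⟨u,v⟩h + ad λ_{u×v}`), `E ≠ 0`.
[cite: LooijengaLunts1997, §4 (4.4) (iii) (proof), (4.2) (proof: "[e_a, f_b] = −(ab⁻¹)₀ + ¼Tr(ab⁻¹)h")] -/
theorem lefschetzDualTwistor_apply_mem_adjoin_of_mem_closure [Nontrivial E] (h : IsLinearHyperkaehler g₀ J)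
    (v : Fin 3 → ℝ) {x : GForm E ℂ}
    (hx : x ∈ Submonoid.closure (Set.range fun u : Fin 3 → ℝ ↦ lefschetzTwistor g₀ J u 1)) :
    h.lefschetzDualTwistor v x ∈ Algebra.adjoin ℂ (Set.range fun u : Fin 3 → ℝ ↦ lefschetzTwistor g₀ J u 1) := by
  induction hx using Submonoid.closure_induction_left with
  | one => rw [lefschetzDualTwistor_apply_one]; exact zero_mem _
  | mul_left g hg y hy ih =>
    obtain ⟨u, rfl⟩ := hg
    have e : lefschetzTwistor g₀ J u (h.lefschetzDualTwistor v y) - h.lefschetzDualTwistor v (lefschetzTwistor g₀ J u y) =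
        ((u ⬝ᵥ v) • countingG E + adTwistor J (u ⨯₃ v)) y := LinearMap.congr_fun (h.lie_L_Λ u v) y
    have e' : h.lefschetzDualTwistor v (lefschetzTwistor g₀ J u y) =
        lefschetzTwistor g₀ J u (h.lefschetzDualTwistor v y) - ((u ⬝ᵥ v) • countingG E + adTwistor J (u ⨯₃ v)) y := by
      rw [← e, sub_sub_cancel]
    rw [← lefschetzTwistor_apply_eq_mul, e', LinearMap.add_apply, LinearMap.smul_apply,
      RCLike.real_smul_eq_coe_smul (K := ℂ)]
    exact sub_mem (lefschetzTwistor_apply_mem_adjoin u ih)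
      (add_mem (Subalgebra.smul_mem _ (countingG_apply_mem_adjoin_of_mem_closure hy) _)
        (h.adTwistor_apply_mem_adjoin_of_mem_closure _ hy))

/-- **Looijenga–Lunts (4.2)(iv) / (4.4)(iii), first clause: the subalgebra `A_𝔞 ⊂ H•(X)` generated by the Kähler
forms of the induced complex structures is invariant under `𝔤(ℍ) = 𝔞 ≅ 𝔰𝔬(4,1)`** — `𝔞 ≤ stabilizer A_𝔞`: every
`T = L_u + Λ_v + ad λ_w + t h ∈ 𝔞` maps `A_𝔞 = ℂ[κ_u : u ∈ ℝ³]` into itself (`E ≠ 0`).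
[cite: LooijengaLunts1997, §4 (4.2) (iv), (4.4) (iii)] [cite: Verbitsky1997HyperholomorphicSheaves, §4.2] -/
theorem verbitskyAlgebra_le_stabilizer_adjoin [Nontrivial E] (h : IsLinearHyperkaehler g₀ J) :
    verbitskyAlgebra g₀ J ≤
      stabilizer (Subalgebra.toSubmodule (Algebra.adjoin ℂ (Set.range fun u : Fin 3 → ℝ ↦ lefschetzTwistor g₀ J u 1))) := by
  intro T hT x hx
  obtain ⟨u, v, w, t, rfl⟩ := h.mem_verbitskyAlgebra_iff.1 hT
  rw [Subalgebra.mem_toSubmodule] at hx ⊢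
  rw [LinearMap.add_apply, LinearMap.add_apply, LinearMap.add_apply, LinearMap.smul_apply,
    RCLike.real_smul_eq_coe_smul (K := ℂ)]
  refine add_mem (add_mem (add_mem (lefschetzTwistor_apply_mem_adjoin u hx) ?_) ?_) (Subalgebra.smul_mem _ ?_ _)
  · exact apply_mem_adjoin_of_closure _ (fun y hy ↦ h.lefschetzDualTwistor_apply_mem_adjoin_of_mem_closure v hy) x hx
  · exact apply_mem_adjoin_of_closure _ (fun y hy ↦ h.adTwistor_apply_mem_adjoin_of_mem_closure w hy) x hx
  · exact apply_mem_adjoin_of_closure _ (fun y hy ↦ countingG_apply_mem_adjoin_of_mem_closure hy) x hx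

/-- **Verbitsky's `𝔤 ≅ 𝔰𝔲(2)` preserves `A_𝔞`** (the isotropy algebra of the `ad λ_w` is contained in `𝔞`).
[cite: LooijengaLunts1997, §4 (4.4) (ii)–(iii)] [cite: Verbitsky1997HyperholomorphicSheaves, §4.2] -/
theorem isotropyAlgebra_le_stabilizer_adjoin [Nontrivial E] (h : IsLinearHyperkaehler g₀ J) :
    isotropyAlgebra J ≤
      stabilizer (Subalgebra.toSubmodule (Algebra.adjoin ℂ (Set.range fun u : Fin 3 → ℝ ↦ lefschetzTwistor g₀ J u 1))) :=
  h.isotropyAlgebra_le_verbitskyAlgebra.trans h.verbitskyAlgebra_le_stabilizer_adjoin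

/-- Elementwise form: `T x ∈ A_𝔞` for `T ∈ 𝔞`, `x ∈ A_𝔞`. [cite: LooijengaLunts1997, §4 (4.4) (iii)] -/
theorem apply_mem_adjoin_of_mem_verbitskyAlgebra [Nontrivial E] (h : IsLinearHyperkaehler g₀ J)
    {T : Module.End ℂ (GForm E ℂ)} (hT : T ∈ verbitskyAlgebra g₀ J) {x : GForm E ℂ}
    (hx : x ∈ Algebra.adjoin ℂ (Set.range fun u : Fin 3 → ℝ ↦ lefschetzTwistor g₀ J u (1 : GForm E ℂ))) :
    T x ∈ Algebra.adjoin ℂ (Set.range fun u : Fin 3 → ℝ ↦ lefschetzTwistor g₀ J u (1 : GForm E ℂ)) :=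
  h.verbitskyAlgebra_le_stabilizer_adjoin hT x hx

/-- The generator `L_{ω_λ}`, `λ ∈ S²`, of `𝔞` preserves `A_𝔞`. [cite: LooijengaLunts1997, §4 (4.2) (iv)] -/
theorem lefschetzG_apply_mem_adjoin [Nontrivial E] (h : IsLinearHyperkaehler g₀ J) {y : Fin 3 → ℝ}
    (hy : y 0 ^ 2 + y 1 ^ 2 + y 2 ^ 2 = 1) {x : GForm E ℂ}
    (hx : x ∈ Algebra.adjoin ℂ (Set.range fun u : Fin 3 → ℝ ↦ lefschetzTwistor g₀ J u (1 : GForm E ℂ))) :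
    lefschetzG (fundamentalForm g₀ (y 0 • opI E + y 1 • J + y 2 • opK J)) x ∈
      Algebra.adjoin ℂ (Set.range fun u : Fin 3 → ℝ ↦ lefschetzTwistor g₀ J u (1 : GForm E ℂ)) :=
  h.apply_mem_adjoin_of_mem_verbitskyAlgebra (lefschetzG_mem_verbitskyAlgebra hy) hx

/-- The generator `Λ_{ω_λ}`, `λ ∈ S²`, of `𝔞` preserves `A_𝔞` ("Hence `A_𝔞` is also invariant under `f_a`").
[cite: LooijengaLunts1997, §4 (4.4) (iii)] -/
theorem lefschetzDualG_apply_mem_adjoin [Nontrivial E] (h : IsLinearHyperkaehler g₀ J) {y : Fin 3 → ℝ}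
    (hy : y 0 ^ 2 + y 1 ^ 2 + y 2 ^ 2 = 1) {x : GForm E ℂ}
    (hx : x ∈ Algebra.adjoin ℂ (Set.range fun u : Fin 3 → ℝ ↦ lefschetzTwistor g₀ J u (1 : GForm E ℂ))) :
    lefschetzDualG (fundamentalForm g₀ (y 0 • opI E + y 1 • J + y 2 • opK J)) x ∈
      Algebra.adjoin ℂ (Set.range fun u : Fin 3 → ℝ ↦ lefschetzTwistor g₀ J u (1 : GForm E ℂ)) :=
  h.apply_mem_adjoin_of_mem_verbitskyAlgebra (lefschetzDualG_mem_verbitskyAlgebra hy) hx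

end IsLinearHyperkaehler

end Literature.Geometry.Hyperkaehler

end
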